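import Summits.BirchSwinnertonDyer.BirchSwinnertonDyer.Theorems.ByReductionTypeAtTwoAdditivePotGoodPrintFamily56b1ShaTrivial
import Summits.BirchSwinnertonDyer.BirchSwinnertonDyer.Theorems.ByReductionTypeAtTwoAdditivePotGoodPrintFamily56b1Witness
import Summits.BirchSwinnertonDyer.Rank1Residual.Supersingular.RationalLadder
import Literature.NumberTheory.EllipticCurves.LutzNagellGeneralWeierstrass
import Literature.NumberTheory.EllipticCurves.MazurTorsionOrderValuationProofs
import Literature.NumberTheory.EllipticCurves.RegulatorProofs
import HarnessLib

/-!
# K4 crux `AdditiveRankZeroAtTwo` (19098), children C3″ (22617) / C2″ (22616): `#56b1(ℚ)_tors = 2` IN THE KERNEL and the record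
# `ord₂ #Ш_an(56b1) = 0` reduced to the LOCAL record `ord₂ Tam(56b1) = 1`

Cell `bsd-2adic`, seat `bsd-2adic-k4-w2` GEN 5 (prover, explicit unit, no kit); `--supports stmt-BirchSwinnertonDyer-22617
--as helper`. HONEST FRAMING (D-0036/D-0054): after `…PrintFamily56b1ShaTrivial.lean` (p683767) the `56b1` Thm-1.5 road displays
the optimal datum and two numeric records, `ord₂(L(56b1,1)/Ω) = −1` and `ord₂ #Ш_an(56b1) = 0`. THIS FILE: (§1) **`#56b1(ℚ)_tors = 2`
in the kernel** — `#E(ℚ)_tors ∣ #Ẽ(𝔽₃) = 2` (Knapp V.5.1(c), tree `torsionOrder_dvd_reductionPointCount`; `#Ẽ(𝔽₃)` by the certified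
`countPoints`) and `T = (2,0)` has order `2`; with `rank 56b1 = 0` (Descent file) and `Reg = 1` this is CLZ's printed «`A(ℚ) = ℤ/2ℤ`»;
(§2) `#Ш_an(56b1) = L(56b1,1)·#tors²/(Ω·Tam·Reg) = 4q/Tam(56b1)` for `L(56b1,1) = q·Ω`, so `ord₂ #Ш_an(56b1) = 1 − ord₂ Tam(56b1)`
(`shaAn_C56B1_eq`, `padicValRat_shaAn_C56B1`): the record `ord₂ #Ш_an = 0` is EQUIVALENT to the local record `ord₂ Tam(56b1) = 1`
(Cremona: `c₂·c₇`; the kernel has no Tate algorithm at the additive prime `2` to evaluate it); (§3) `bsdp_two_C56B1_of_tamagawa` and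
`printFamily56b1_of_thm15_certified''` — the road displaying: optimal datum, `ord₂(L(56b1,1)/Ω) = −1`, `ord₂ Tam(56b1) = 1`.
Closes nothing at the `∀`-level; BSD is not proved by any of this.

References: [Knapp1993] Thm. V.5.1(c); [SilvermanAEC2009] III.2.3(d), VII.3.1(b), C.16; [Miller2011LMS] Def. 1.1; [CaiLiZhai2019]
Thm. 1.1, 1.5, §6.2.2.
-/

set_option autoImplicit false
set_option linter.dupNamespace false

noncomputable section

open scoped Classical

open WeierstrassCurve Literature.NumberTheory.EllipticCurves
  Literature.NumberTheory.EllipticCurves.Rank1Residual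
  Literature.NumberTheory.EllipticCurves.Rank1Residual.Typed
  Literature.NumberTheory.EllipticCurves.CaiLiZhai2019
  Literature.NumberTheory.EllipticCurves.ModularForms
  Literature.NumberTheory.EllipticCurves.AgasheRibetStein2006
  Literature.NumberTheory.EllipticCurves.LutzNagellGeneral
  Literature.NumberTheory.EllipticCurves.Rank1Residual.X11RankOneCertificates
  Summit.BirchSwinnertonDyer.Rank1Residual
  Summit.BirchSwinnertonDyer.Rank1Residual.X5.O1
  Summit.BirchSwinnertonDyer.Rank1Residual.P2
  Summit.BirchSwinnertonDyer.Rank1Residual.Supersingular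
  Summit.BirchSwinnertonDyer.BirchSwinnertonDyer.Rank1Residual.IntModel

namespace Summit.BirchSwinnertonDyer.BirchSwinnertonDyer.Theorems.AddPotGoodPrint

/-! ## §1 `#56b1(ℚ)_tors = 2` -/

/-- `Δ_min(56b1) = −7168 = −2¹⁰·7`. [cite: CaiLiZhai2019, §6.2.2] -/
theorem minimalDiscriminantInt_C56B1 [C56B1.IsGloballyMinimal] : minimalDiscriminantInt C56B1 = -7168 := by
  rw [minimalDiscriminantInt_eq integralModelInt_C56B1]
  simp only [WeierstrassCurve.Δ, WeierstrassCurve.b₂, WeierstrassCurve.b₄, WeierstrassCurve.b₆, WeierstrassCurve.b₈]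
  norm_num

/-- **`#Ẽ(𝔽₃) = 2` for `56b1`** (`x³ − x² − 4 ≡ 2, 2, 0 (mod 3)` at `x = 0, 1, 2`; `2` is a non-residue): the points `O` and `(2,0)`.
Certified `countPoints`, `decide +kernel`. [cite: SilvermanAEC2009, V.2] -/
theorem reductionPointCount_3_C56B1 [C56B1.IsGloballyMinimal] : C56B1.reductionPointCount 3 = 2 := by
  haveI : Fact (Nat.Prime 3) := ⟨Nat.prime_three⟩
  exact reductionPointCount_eq_of_intModel_countPoints integralModelInt_C56B1 3 (by norm_num) (by decide +kernel)
    (by decide +kernel)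

/-- `T = (2, 0)` lies on `56b1` and is nonsingular. [cite: CaiLiZhai2019, §6.2.2] -/
theorem nonsingular_C56B1_two_zero [C56B1.IsElliptic] : C56B1.toAffine.Nonsingular 2 0 :=
  Affine.equation_iff_nonsingular.mp ((Affine.equation_iff _ _).mpr (by norm_num [C56B1]))

/-- `2 • T = 0` for `T = (2,0)` (`2y + a₁x + a₃ = 0`; Silverman III.2.3(d)). [cite: SilvermanAEC2009, III.2.3(d)] -/
theorem two_nsmul_T_C56B1 [C56B1.IsElliptic] :
    (2 : ℕ) • (Affine.Point.some 2 0 nonsingular_C56B1_two_zero : C56B1.toAffine.Point) = 0 := by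
  rw [two_nsmul, add_eq_zero_iff_eq_neg, Affine.Point.neg_some, Affine.Point.some.injEq, Affine.negY]
  exact ⟨rfl, by norm_num [C56B1]⟩

/-- **`#56b1(ℚ)_tors = 2` — IN THE KERNEL** (`#E(ℚ)_tors ∣ #Ẽ(𝔽₃) = 2` and `T = (2,0)` has order `2`). CLZ print: «`A(ℚ) = ℤ/2ℤ`»
(with `rank 56b1 = 0`, `mordellWeilRank_C56B1`). [cite: Knapp1993, Ch. V §1 Thm. 5.1(c)] [cite: CaiLiZhai2019, §6.2.2] -/
theorem torsionOrder_C56B1 [C56B1.IsElliptic] [C56B1.IsGloballyMinimal] : C56B1.torsionOrder = 2 := by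
  haveI : Fact (Nat.Prime 3) := ⟨Nat.prime_three⟩
  haveI : Fact (Nat.Prime 2) := ⟨Nat.prime_two⟩
  have hdvd : C56B1.torsionOrder ∣ 2 := by
    have h := torsionOrder_dvd_reductionPointCount C56B1 3 (Or.inl (by norm_num))
      (by rw [minimalDiscriminantInt_C56B1]; norm_num)
    rwa [reductionPointCount_3_C56B1] at h
  have h2 : 2 ∣ C56B1.torsionOrder :=
    dvd_torsionOrder_of_nsmul_eq_zero C56B1 2 two_nsmul_T_C56B1 (Affine.Point.some_ne_zero _)
  exact Nat.dvd_antisymm hdvd h2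

/-! ## §2 `#Ш_an(56b1) = 4q / Tam(56b1)` -/

/-- **`#Ш_an(56b1) = 4·(L(56b1,1)/Ω) / Tam(56b1)`** as a rational number, from `r_an = 0` (modularity + `L(56b1,1) = q·Ω ≠ 0`),
`#tors = 2`, `Reg = 1` (`rank = 0`). [cite: Miller2011LMS, §1 (definition of #Ш_an)] -/
theorem shaAn_C56B1_eq (hmod : hasEntireLFunction_rat) [C56B1.IsElliptic] [C56B1.IsGloballyMinimal] {q : ℚ}
    (hq : C56B1.entireLFunction 1 = (q : ℂ) * (C56B1.realPeriodRat : ℂ)) (hv : padicValRat 2 q = -1) :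
    shaAn C56B1 = ((4 * q / C56B1.tamagawaProduct : ℚ) : ℂ) := by
  have hr : C56B1.analyticRank = 0 := analyticRank_C56B1 hmod ⟨q, hq, hv⟩
  have hΩ : (C56B1.realPeriodRat : ℂ) ≠ 0 := by exact_mod_cast ne_of_gt C56B1.realPeriodRat_pos_holds
  rw [shaAn_def, leadingLCoeff_eq_of_analyticRank_eq_zero _ hr, hq, torsionOrder_C56B1,
    regulator_eq_one_of_rank_zero _ mordellWeilRank_C56B1]
  push_cast
  field_simp
  ring

/-- **`ord₂ #Ш_an(56b1) = 1 − ord₂ Tam(56b1)`**: with `#Ш_an = 4q/Tam` and `ord₂ q = −1`. [cite: Miller2011LMS, §1] -/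
theorem padicValRat_shaAn_C56B1 [C56B1.IsElliptic] {q : ℚ} (hq0 : q ≠ 0) (hv : padicValRat 2 q = -1)
    (hT : C56B1.tamagawaProduct ≠ 0) :
    padicValRat 2 (4 * q / C56B1.tamagawaProduct : ℚ) = 1 - padicValNat 2 C56B1.tamagawaProduct := by
  haveI : Fact (Nat.Prime 2) := ⟨Nat.prime_two⟩
  have hT' : (C56B1.tamagawaProduct : ℚ) ≠ 0 := by exact_mod_cast hT
  have h4 : padicValRat 2 (4 : ℚ) = 2 := by
    rw [show (4 : ℚ) = ((2 ^ 2 : ℕ) : ℚ) by norm_num, padicValRat.of_nat, padicValNat.prime_pow]; norm_num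
  rw [padicValRat.div (mul_ne_zero (by norm_num) hq0) hT', padicValRat.mul (by norm_num) hq0, hv,
    padicValRat.of_nat, h4]
  ring

/-! ## §3 Miller's `BSD(56b1, 2)` from `ord₂ L/Ω = −1` and `ord₂ Tam = 1` -/

/-- **Miller's `BSD(56b1, 2)` ⟸ modularity + the record `ord₂(L(56b1,1)/Ω) = −1` + the LOCAL record `ord₂ Tam(56b1) = 1`**
(kernel: `rank = 0`, `#tors = 2`, `Reg = 1`, `Ш(56b1)[2^∞] = 0`). [cite: Miller2011LMS, Def. 1.1] [cite: CaiLiZhai2019, §6.2.2] -/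
theorem bsdp_two_C56B1_of_tamagawa (hmod : hasEntireLFunction_rat) [C56B1.IsElliptic] [C56B1.IsGloballyMinimal]
    (hL : ∃ q : ℚ, C56B1.entireLFunction 1 = (q : ℂ) * (C56B1.realPeriodRat : ℂ) ∧ padicValRat 2 q = -1)
    (hTam : padicValNat 2 C56B1.tamagawaProduct = 1) : BSDp C56B1 2 := by
  obtain ⟨q, hq, hv⟩ := hL
  have hq0 : q ≠ 0 := by rintro rfl; simp at hv
  have hT : C56B1.tamagawaProduct ≠ 0 := by
    intro h; rw [h] at hTam; simp at hTam
  refine bsdp_two_C56B1_of_shaAn hmod ⟨q, hq, hv⟩ ⟨4 * q / C56B1.tamagawaProduct, shaAn_C56B1_eq hmod hq hv, ?_⟩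
  rw [padicValRat_shaAn_C56B1 hq0 hv hT, hTam]
  norm_num

/-- **BSD₂ (both K4 halves, `Ш(W)(2) = 0`) on the `2N`-split sub-family of `56b1^{(∏Q)}`**, displaying: the optimal datum
(`Dt`, `hopt`), `ord₂(L(56b1,1)/Ω) = −1` (`hL`), `ord₂ Tam(56b1) = 1` (`hTam`); kernel: everything else (incl. `#tors = 2`,
`rank = 0`, `Ш(56b1)[2^∞] = 0`, `#E[2] = 2`, the `2`-isogeny, `Ш(E′)[2] = 0`, habitat); inputs BY NAME CLZ Thm. 1.1/1.5, ARS Thm.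
2.6, modularity, GZK. BSD is not proved by any of this.
[cite: CaiLiZhai2019, Thm. 1.1 and Thm. 1.5] [cite: AgasheRibetStein2006, Thm. 2.6] [cite: Miller2011LMS, Def. 1.1] -/
theorem printFamily56b1_of_thm15_certified'' (h11 : thm11_ord_two_LAlg_twist) (h15 : thm15_twoPartBSD_twist)
    (h26 : cremona_abs_maninConstant_eq_one_of_level_le) (hmod : hasEntireLFunction_rat)
    (hGZK : rank_eq_analyticRank_of_analyticRank_le_one)
    [C56B1.IsElliptic] [C56B1.IsGloballyMinimal] [NeZero (C56B1.conductorNorm ℤ)]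
    (Dt : ModularParametrizationData C56B1 (C56B1.conductorNorm ℤ))
    (hopt : ∀ z ∈ Dt.L.lattice, ∃ w ∈ periodLattice Dt.f, z = Dt.c * w)
    (hL : ∃ q : ℚ, C56B1.entireLFunction 1 = (q : ℂ) * (C56B1.realPeriodRat : ℂ) ∧ padicValRat 2 q = -1)
    (hTam : padicValNat 2 C56B1.tamagawaProduct = 1)
    (Q : Finset ℕ) (hQ : Q.Nonempty) (hS : ∀ q ∈ Q, InS C56B1 q)
    (hsplit : ∀ (K : Type) [Field K] [NumberField K], Module.finrank ℚ K = 2 →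
      (∃ x : K, x ^ 2 = ((∏ q ∈ Q, q : ℕ) : K)) → SatisfiesHeegnerHypothesis (2 * C56B1.conductorNorm ℤ) K)
    (W : WeierstrassCurve ℚ) [W.IsElliptic] [W.IsGloballyMinimal]
    (hW : ∃ C : VariableChange ℚ, C • C56B1.quadraticTwist ((∏ q ∈ Q, q : ℕ) : ℚ) = W) :
    W.analyticRank = 0 ∧ Addv W 2 ∧ 0 ≤ padicValRat 2 W.j ∧ ¬ W.HasCM ∧ Red W 2 ∧
      AddCommGroup.primaryComponent W.sha 2 = ⊥ ∧ BSDp W 2 ∧ MissingLowerBoundAt W 2 ∧ MissingUpperBoundAt W 2 :=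
  printFamily56b1_of_thm15_certified h11 h15 h26 hmod hGZK Dt hopt hL (bsdp_two_C56B1_of_tamagawa hmod hL hTam) Q hQ hS
    hsplit W hW

end Summit.BirchSwinnertonDyer.BirchSwinnertonDyer.Theorems.AddPotGoodPrint

end
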